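import Summits.QuantumFields.BalabanUV.T4Continuum.Support.BlockPairingFaces
import Summits.QuantumFields.BalabanUV.Beta.GAN24.SoftColumnVertexRate
import Summits.QuantumFields.BalabanUV.Beta.GAN24.ChainLeibnizGrad

/-!
# `BalabanUV.Beta.GAN24.SoftColumnGradVertexRate` — binder row G-an2-4 ∕ (CONV-C), route R7 «TWO CURRENCIES», S4 EXECUTED ON NE2-P1's
# TYPED `U = 1` TOWER FOR THE GRADIENT VERTEX (the SHAPE of Bałaban's cubic table `S‴(0)[h,h,h]` ∕ T1's cubic row: ONE lattice derivative
# on one of three soft-minimiser columns): the staircase transport is STILL EXACT, and the one-step sup rate `θ₁ = L⁻¹` holds MODULO THE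
# SAME ZEROTH-ORDER LETTER `hcol` ONLY — no gradient sup letter `hcol′`

NOT IN PRINT; OUR PROOF ATTEMPT (prover part P3 of row G-an2-4, fibre∕strip («Woodbury») lineage, gen 25; CRUX TEAM (2), ruling «YM
REDIRECT TOWARDS THE SUMMIT», 2026-08-21).  HONEST DEPENDENCY (cell records, verbatim): «continuum YM on T⁴ ⇐ BetaPertH ∧ nine spine
estimates (0/9 proved); BetaPertH ⇐ (D1) ∧ (D4) ∧ CAP+tail; G-an2-4 gates asym, D1 and NE2/3/4.»  HONEST FRAMING (cell contract, verbatim):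
«discharging `BetaPertH` makes Bałaban's UV stability UNCONDITIONAL — a real constructive-QFT result; it is NOT the continuum limit and NOT
the Clay problem.»  ABSOLUTE RULE: nothing printed is a hypothesis; no `def … : Prop`, no sorry; [folklore] algebra over TREE objects BY NAME.

## Answer to refuter PRICING-GAN24 v3.7 check #38 (c) ∕ idea-1 ROUTES-GAN24 v7 «(C) models T1's cubic row only with the second sup letter
## `hcol′` ((1.65) gradient clause)» — NOT NEEDED for the cubic row:

 * §1 **EXACT TRANSPORT OF THE GRADIENT VERTEX** under King's staircase `J_k`: `∇′_ν(J_ku) = L·F_ν·J_k(∇_νu)` (NE2's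
   `BlockPairingGeometry.fdiff_mul_JK`: a planted field changes only across the far `ν`-faces, where the finer difference quotient is `L`
   times the coarser one) and the far face holds `L^{d−1}` of the `L^d` sites of a block (`BlockPairingFaces.sum_indicator_face`) ⟹
   **`vtx₃_fdiff_Jpc`** `vtx₃ C (∇′(Jf)) (Jg) (Jh) = (√(L^d))⁻¹·vtx₃ C (∇f) g h` and **`V₃_grad_transport`**
   `V₃ (k+1) C (∇′(J_kf)) (J_kg) (J_kh) = V₃ k C (∇f) g h` — the face concentration `L·F_ν` and the face count `L^{d−1}` multiply to `L^d`
   EXACTLY as for the value vertex.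
 * §2 the `ℓ²` GRADIENT letters of the soft columns are TREE facts: **`opNorm_fdiff_Mtil_le`** `‖∇_νM̃_k‖ ≤ a·Cst(d,a)` (b05's (1.89) item
   `‖∇𝒢‖ ≤ Cst`, `B5Prop11Plancherel.opNorm_fdiff_calG_le`), `nsq_fdiff_colS_le`; and the staircased gradient column costs only `√L`:
   **`nsq_fdiff_Jpc_mulVec`** `nsq (∇′(J_ku)) = L·nsq (∇u)` (EXACT: `L²` from the face quotient × `L^{d−1}∕L^d` from the face count).
 * §3 **`V₃_gradcol_succ_sub_le`**: under the ONE displayed zeroth-order letter `hcol : ∀ k q X, √(n_k^d)·‖M̃_k X q‖ ≤ C` of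
   `SoftColumnVertexRate`, for every coefficient tensor `C`, direction `ν`, unit sites∕components `p q r`, every `k`:
   `‖V₃ (k+1) C [∇′M̃_{k+1}e_p, M̃_{k+1}e_q, M̃_{k+1}e_r] − V₃ k C [∇M̃_ke_p, M̃_ke_q, M̃_ke_r]‖ ≤ (2 + 2√L)·‖C‖₁·C·(a·Cst)·(a·CQH)·L^{−k}`.
   MECHANISM: transport (§1) + `ChainLeibniz.vtx₃_leibniz`; the term with the DIFFERENCED gradient leg by `ChainLeibnizGrad`'s summation by
   parts (`δ` in `ℓ²` = `opNorm_Mtil_succ_sub_le`, neighbours by `hcol` + §2's `ℓ²` gradient letters); the two terms with an undifferenced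
   staircased gradient leg by `norm_vtx₃_le_right∕_le_mid` with `∇′(J·)` in `ℓ²` (`√L·a·Cst`) — «never difference the derivative leg in ℓ²».

HONEST SCOPE.  MODEL chain on typed objects (the value-level SHAPE of the cubic vertex `(∇h)·[h, h]`; no claim that it IS T1 — colour
tensors, HARD∕constrained columns and S1∕S7 are an2's∕p1's); SOFT columns; `U = 1`; every torus `M`, every `L ≥ 1`, `d ≥ 1`, `a > 0`;
CONDITIONAL on the zeroth-order letter `hcol` only (candidate suppliers as in `SoftColumnVertexRate`; INTERFACE REQUEST (R7-HCOL) posted).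
NOT (CONV-C), NOT (ρ2)(ρ3), NEVER «G-an2-4 closed», NOT D1, NOT BetaPertH, NOT continuum, NOT Clay.  Provenance: prover-b2b-balaban-gan24-p3-g25-0
(unit `b2b-balaban-gan24-p3`, gen 25), 2026-08-21.
-/

noncomputable section

open scoped BigOperators ComplexConjugate Matrix Matrix.Norms.L2Operator
open Finset

namespace Summit.QuantumFields.BalabanUV.Beta.GAN24.SoftColumnGradVertexRate

open Literature.MathematicalPhysics.QuantumFieldTheory.Balaban1983to89.B5Prop11Plancherel
open Literature.MathematicalPhysics.QuantumFieldTheory.Balaban1983to89.B5Prop11Lower (nsq nsq_nonneg)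
open Literature.MathematicalPhysics.QuantumFieldTheory.Balaban1983to89.B5G183RateUnitTower (lev lev_neZero)
open Summit.QuantumFields.BalabanUV.T4Continuum.CovariantAveragingTower (Atow)
open Summit.QuantumFields.BalabanUV.T4Continuum.BalabanAveragedTowerUnit (idx lev_succ' one_le_lev' cast_lev' QBlev calGlev)
open Summit.QuantumFields.BalabanUV.T4Continuum.BalabanAveragedTowerModes (par rem par_cpt_add_off rem_cpt_add_off)
open Summit.QuantumFields.BalabanUV.T4Continuum.BalabanBlockPoincare (tileEquiv)
open Summit.QuantumFields.BalabanUV.T4Continuum.BalabanMinimizerLaw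
open Summit.QuantumFields.BalabanUV.T4Continuum.BlockPairingGeometry (faceF fdiff_mul_JK face_cpt_add_off_iff)
open Summit.QuantumFields.BalabanUV.T4Continuum.BlockPairingFaces (sum_indicator_face)
open Summit.QuantumFields.BalabanUV.Beta.GAN24.ChainLeibniz
open Summit.QuantumFields.BalabanUV.Beta.GAN24.ChainLeibnizGrad
open Summit.QuantumFields.BalabanUV.Beta.GAN24.SoftColumnVertexRate

variable {d : ℕ} (L : ℕ) [NeZero L] (M : Fin d → ℕ) [hM : ∀ μ, NeZero (M μ)]

/-- the coarse (level-`k`) forward difference `∇_ν = n_k(S_ν − 1)` on `idx k`. [folklore] -/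
abbrev fd (k : ℕ) (ν : Fin d) : Matrix (idx L M k) (idx L M k) ℂ := fdiff (fine (lev L k) M) ((lev L k : ℕ) : ℂ) ν

/-- the finer (level-`(k+1)`) forward difference at the syntactic successor level `L·n_k`. [folklore] -/
abbrev fdS (k : ℕ) (ν : Fin d) : Matrix (Tor (fine (L * lev L k) M) × Fin d) (Tor (fine (L * lev L k) M) × Fin d) ℂ :=
  fdiff (fine (L * lev L k) M) (((L * lev L k : ℕ)) : ℂ) ν

/-! ## §1 Exact transport of the gradient vertex under the staircase -/

/-- the far-`ν`-face indicator of the finer blocks. [folklore] -/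
def farInd (k : ℕ) (ν : Fin d) (x' : Tor (fine (L * lev L k) M)) : ℂ := if L ∣ (x' ν).val + 1 then 1 else 0

/-- **`∇′_ν(J_ku)`, pointwise**: `= L·𝟙_far(x′)·(√(L^d))⁻¹·(∇_νu)(par x′)` (NE2's `fdiff_mul_JK`). [folklore] -/
theorem fdS_Jpc_mulVec_pt (k : ℕ) (ν : Fin d) (u : idx L M k → ℂ) (x' : Tor (fine (L * lev L k) M) × Fin d) :
    (fdS L M k ν *ᵥ (Jpc L M k *ᵥ u)) x'
      = (L : ℂ) * farInd L M k ν x'.1 * (((Real.sqrt ((L : ℝ) ^ d) : ℝ) : ℂ)⁻¹ * (fd L M k ν *ᵥ u) (par (lev L k) L M x'.1, x'.2)) := by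
  have key := fdiff_mul_JK (lev L k) L M (one_le_lev' L k) ν
  have e : fdS L M k ν *ᵥ (Jpc L M k *ᵥ u) = (L : ℂ) • (faceF (lev L k) L M ν *ᵥ (Jpc L M k *ᵥ (fd L M k ν *ᵥ u))) := by
    rw [Matrix.mulVec_mulVec, show fdS L M k ν * Jpc L M k
      = ((L : ℂ)) • (faceF (lev L k) L M ν * Jpc L M k * fd L M k ν) from key, Matrix.smul_mulVec,
      ← Matrix.mulVec_mulVec, ← Matrix.mulVec_mulVec]
  rw [e, Pi.smul_apply, smul_eq_mul, faceF, Matrix.mulVec_diagonal, Jpc_mulVec_apply, farInd, mul_assoc]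

/-- **the weighted block count**: `Σ_{x′} 𝟙_far(x′)·F(par x′) = L^{d−1}·Σ_x F(x)`. [folklore] -/
theorem sum_farInd_comp_par (k : ℕ) (ν : Fin d) (F : Tor (fine (lev L k) M) → ℂ) :
    ∑ x' : Tor (fine (L * lev L k) M), farInd L M k ν x' * F (par (lev L k) L M x') = (L : ℂ) ^ (d - 1) * ∑ x, F x := by
  rw [← Fintype.sum_equiv (tileEquiv (lev L k) L M)
    (fun p => farInd L M k ν (tileEquiv (lev L k) L M p) * F (par (lev L k) L M (tileEquiv (lev L k) L M p)))
    (fun x' => farInd L M k ν x' * F (par (lev L k) L M x')) (fun p => rfl)]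
  simp only [tileEquiv, Equiv.coe_fn_mk, par_cpt_add_off, farInd]
  rw [Fintype.sum_prod_type, Finset.mul_sum]
  refine Finset.sum_congr rfl fun y _ => ?_
  simp_rw [face_cpt_add_off_iff]
  rw [← Finset.sum_mul, sum_indicator_face L ν]

omit [NeZero L] hM in
/-- `L·L^{d−1} = (√(L^d))²` when a direction `ν : Fin d` exists. [folklore] -/
theorem L_mul_pow_pred (ν : Fin d) :
    (L : ℂ) * (L : ℂ) ^ (d - 1) = (((Real.sqrt ((L : ℝ) ^ d) : ℝ) : ℂ)) * ((Real.sqrt ((L : ℝ) ^ d) : ℝ) : ℂ) := by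
  have hd : 1 ≤ d := Fin.pos ν
  rw [← Complex.ofReal_mul, Real.mul_self_sqrt (pow_nonneg (Nat.cast_nonneg _) d), ← pow_succ', Nat.sub_add_cancel hd]
  push_cast; rfl

/-- **EXACT TRANSPORT OF THE GRADIENT VERTEX (un-normalised)**: `vtx₃ C (∇′(Jf)) (Jg) (Jh) = (√(L^d))⁻¹·vtx₃ C (∇f) g h`. [folklore] -/
theorem vtx₃_fdiff_Jpc (k : ℕ) (ν : Fin d) (C : Fin d → Fin d → Fin d → ℂ) (f g h : idx L M k → ℂ) :
    vtx₃ C (fdS L M k ν *ᵥ (Jpc L M k *ᵥ f)) (Jpc L M k *ᵥ g) (Jpc L M k *ᵥ h)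
      = ((Real.sqrt ((L : ℝ) ^ d) : ℝ) : ℂ)⁻¹ * vtx₃ C (fd L M k ν *ᵥ f) g h := by
  set s : ℂ := ((Real.sqrt ((L : ℝ) ^ d) : ℝ) : ℂ) with hs_def
  have hs : s ≠ 0 := by
    rw [hs_def]; exact_mod_cast (Real.sqrt_pos.mpr (pow_pos (by exact_mod_cast Nat.pos_of_ne_zero (NeZero.ne L)) d) : 0 < Real.sqrt ((L : ℝ) ^ d)).ne'
  have hss : (L : ℂ) * (L : ℂ) ^ (d - 1) = s * s := by rw [hs_def]; exact L_mul_pow_pred (d := d) L ν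
  have e1 : vtx₃ C (fdS L M k ν *ᵥ (Jpc L M k *ᵥ f)) (Jpc L M k *ᵥ g) (Jpc L M k *ᵥ h)
      = ∑ x' : Tor (fine (L * lev L k) M), ((L : ℂ) * (s⁻¹ * s⁻¹ * s⁻¹)) * (farInd L M k ν x' *
          ∑ i, ∑ j, ∑ l, C i j l * ((fd L M k ν *ᵥ f) (par (lev L k) L M x', i) * g (par (lev L k) L M x', j)
            * h (par (lev L k) L M x', l))) := by
    rw [vtx₃]
    refine Finset.sum_congr rfl fun x' _ => ?_
    simp only [fdS_Jpc_mulVec_pt, Jpc_mulVec_apply, Finset.mul_sum]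
    refine Finset.sum_congr rfl fun i _ => Finset.sum_congr rfl fun j _ => Finset.sum_congr rfl fun l _ => ?_
    rw [← hs_def]; ring
  rw [e1, ← Finset.mul_sum,
    sum_farInd_comp_par L M k ν (fun y => ∑ i, ∑ j, ∑ l, C i j l * ((fd L M k ν *ᵥ f) (y, i) * g (y, j) * h (y, l))), vtx₃]
  calc (L : ℂ) * (s⁻¹ * s⁻¹ * s⁻¹) * ((L : ℂ) ^ (d - 1) * ∑ x, ∑ i, ∑ j, ∑ l,
        C i j l * ((fd L M k ν *ᵥ f) (x, i) * g (x, j) * h (x, l)))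
      = ((L : ℂ) * (L : ℂ) ^ (d - 1)) * (s⁻¹ * s⁻¹ * s⁻¹) * ∑ x, ∑ i, ∑ j, ∑ l,
        C i j l * ((fd L M k ν *ᵥ f) (x, i) * g (x, j) * h (x, l)) := by ring
    _ = s⁻¹ * ∑ x, ∑ i, ∑ j, ∑ l, C i j l * ((fd L M k ν *ᵥ f) (x, i) * g (x, j) * h (x, l)) := by
        rw [hss]; field_simp

/-- **EXACT TRANSPORT OF THE GRADIENT VERTEX**: `V₃ (k+1) C (∇′(J_kf)) (J_kg) (J_kh) = V₃ k C (∇f) g h`. [folklore] -/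
theorem V₃_grad_transport (k : ℕ) (ν : Fin d) (C : Fin d → Fin d → Fin d → ℂ) (f g h : idx L M k → ℂ) :
    V₃ L (k + 1) C (fdS L M k ν *ᵥ (Jpc L M k *ᵥ f)) (Jpc L M k *ᵥ g) (Jpc L M k *ᵥ h) = V₃ L k C (fd L M k ν *ᵥ f) g h := by
  have hs : (((Real.sqrt ((L : ℝ) ^ d) : ℝ) : ℂ)) ≠ 0 := by
    exact_mod_cast (Real.sqrt_pos.mpr (pow_pos (by exact_mod_cast Nat.pos_of_ne_zero (NeZero.ne L)) d) : 0 < Real.sqrt ((L : ℝ) ^ d)).ne'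
  rw [V₃, V₃, vtx₃_fdiff_Jpc, sqrt_pow_succ, Complex.ofReal_mul]
  calc (((Real.sqrt ((L : ℝ) ^ d) : ℝ) : ℂ)) * ((Real.sqrt (((L : ℝ) ^ d) ^ k) : ℝ) : ℂ)
        * ((((Real.sqrt ((L : ℝ) ^ d) : ℝ) : ℂ))⁻¹ * vtx₃ C (fd L M k ν *ᵥ f) g h)
      = ((((Real.sqrt ((L : ℝ) ^ d) : ℝ) : ℂ)) * (((Real.sqrt ((L : ℝ) ^ d) : ℝ) : ℂ))⁻¹)
          * (((Real.sqrt (((L : ℝ) ^ d) ^ k) : ℝ) : ℂ) * vtx₃ C (fd L M k ν *ᵥ f) g h) := by ring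
    _ = ((Real.sqrt (((L : ℝ) ^ d) ^ k) : ℝ) : ℂ) * vtx₃ C (fd L M k ν *ᵥ f) g h := by rw [mul_inv_cancel₀ hs, one_mul]

/-! ## §2 The `ℓ²` gradient letters of the soft columns (TREE facts) -/

variable (a : ℝ) (ha : 0 < a)

/-- **`‖∇_νM̃_k‖ ≤ a·Cst(d,a)`**, uniformly in `k` ((1.89): `‖∇𝒢‖ ≤ Cst`, `B5Prop11Plancherel.opNorm_fdiff_calG_le`). [folklore] -/
theorem opNorm_fdiff_Mtil_le (k : ℕ) (ν : Fin d) : ‖fd L M k ν * Mtil L M a ha k‖ ≤ a * Cst d a := by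
  have ht0 := sqrt_pow_pos (d := d) L k
  have hG : ‖fd L M k ν * calGlev L M a ha k‖ ≤ Cst d a := opNorm_fdiff_calG_le (lev L k) (one_le_lev' L k) M a ha ν
  have hA : ‖(Atow (QBlev L M) k)ᴴ‖ ≤ (Real.sqrt (((L : ℝ) ^ d) ^ k))⁻¹ := by
    rw [Matrix.l2_opNorm_conjTranspose]; exact opNorm_Atow_QBlev_le L M k
  rw [Mtil, Matrix.mul_smul, norm_smul, Complex.norm_real, Real.norm_of_nonneg (mul_nonneg ht0.le ha.le), ← Matrix.mul_assoc]
  calc Real.sqrt (((L : ℝ) ^ d) ^ k) * a * ‖fd L M k ν * calGlev L M a ha k * (Atow (QBlev L M) k)ᴴ‖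
      ≤ Real.sqrt (((L : ℝ) ^ d) ^ k) * a * (Cst d a * (Real.sqrt (((L : ℝ) ^ d) ^ k))⁻¹) := by
        refine mul_le_mul_of_nonneg_left ?_ (mul_nonneg ht0.le ha.le)
        exact (Matrix.l2_opNorm_mul _ _).trans (mul_le_mul hG hA (norm_nonneg _) (Cst_nonneg d a))
    _ = a * Cst d a := by field_simp

/-- the same at the syntactic successor level. [folklore] -/
theorem opNorm_fdS_Mtil_le (k : ℕ) (ν : Fin d) : ‖fdS L M k ν * atSucc' L M k (Mtil L M a ha (k + 1))‖ ≤ a * Cst d a :=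
  opNorm_fdiff_Mtil_le L M a ha (k + 1) ν

/-- columns of a product. [folklore] -/
theorem mul_col_eq_mulVec {m k o : Type*} [Fintype k] (A : Matrix m k ℂ) (B : Matrix k o ℂ) (q : o) :
    (A * B).col q = A *ᵥ B.col q := rfl

/-- **the gradient of a coarse column in `ℓ²`**: `nsq (∇_ν M̃_ke_q) ≤ (a·Cst)²`. [folklore] -/
theorem nsq_fdiff_col_le (k : ℕ) (ν : Fin d) (q : idx L M 0) : nsq (fd L M k ν *ᵥ col L M a ha k q) ≤ (a * Cst d a) ^ 2 := by
  rw [col, ← mul_col_eq_mulVec]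
  exact (nsq_col_le _ q).trans (pow_le_pow_left₀ (norm_nonneg _) (opNorm_fdiff_Mtil_le L M a ha k ν) 2)

/-- the gradient of a finer column in `ℓ²`: `nsq (∇′_ν M̃_{k+1}e_q) ≤ (a·Cst)²`. [folklore] -/
theorem nsq_fdS_colS_le (k : ℕ) (ν : Fin d) (q : idx L M 0) : nsq (fdS L M k ν *ᵥ colS L M a ha k q) ≤ (a * Cst d a) ^ 2 := by
  rw [colS, ← mul_col_eq_mulVec]
  exact (nsq_col_le _ q).trans (pow_le_pow_left₀ (norm_nonneg _) (opNorm_fdS_Mtil_le L M a ha k ν) 2)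

/-- **the staircased gradient column costs only `√L`**: `nsq (∇′(J_ku)) = L·nsq (∇u)` EXACTLY (face quotient `L²` × face count
`L^{d−1}∕L^d`). [folklore] -/
theorem nsq_fdS_Jpc_mulVec (k : ℕ) (ν : Fin d) (u : idx L M k → ℂ) :
    nsq (fdS L M k ν *ᵥ (Jpc L M k *ᵥ u)) = (L : ℝ) * nsq (fd L M k ν *ᵥ u) := by
  have hLd : (0 : ℝ) < (L : ℝ) ^ d := pow_pos (by exact_mod_cast Nat.pos_of_ne_zero (NeZero.ne L)) d
  have hd : 1 ≤ d := Fin.pos ν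
  -- pointwise squared moduli
  have hpt : ∀ x' : Tor (fine (L * lev L k) M) × Fin d, ‖(fdS L M k ν *ᵥ (Jpc L M k *ᵥ u)) x'‖ ^ 2
      = ((L : ℝ) ^ 2 * ((L : ℝ) ^ d)⁻¹) * ((farInd L M k ν x'.1).re * ‖(fd L M k ν *ᵥ u) (par (lev L k) L M x'.1, x'.2)‖ ^ 2) := by
    intro x'
    rw [fdS_Jpc_mulVec_pt, norm_mul, norm_mul, norm_mul, norm_inv, Complex.norm_real, Real.norm_of_nonneg (Real.sqrt_nonneg _),
      Complex.norm_natCast]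
    have hF : ‖farInd L M k ν x'.1‖ ^ 2 = (farInd L M k ν x'.1).re := by
      unfold farInd; split_ifs <;> simp
    rw [mul_pow, mul_pow, mul_pow, hF, inv_pow, Real.sq_sqrt hLd.le]
    ring
  -- the indicator as a complex sum, then the weighted count
  have hsum : ∑ x' : Tor (fine (L * lev L k) M) × Fin d,
      (farInd L M k ν x'.1).re * ‖(fd L M k ν *ᵥ u) (par (lev L k) L M x'.1, x'.2)‖ ^ 2
        = (L : ℝ) ^ (d - 1) * nsq (fd L M k ν *ᵥ u) := by
    have hc := sum_farInd_comp_par L M k ν (fun y => ∑ i : Fin d, (((‖(fd L M k ν *ᵥ u) (y, i)‖ ^ 2 : ℝ)) : ℂ))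
    have hre := congrArg Complex.re hc
    rw [Complex.re_sum] at hre
    rw [nsq, Fintype.sum_prod_type, Fintype.sum_prod_type]
    have lhs : ∑ x : Tor (fine (L * lev L k) M), ∑ i : Fin d,
        (farInd L M k ν x).re * ‖(fd L M k ν *ᵥ u) (par (lev L k) L M x, i)‖ ^ 2
          = ∑ x : Tor (fine (L * lev L k) M), (farInd L M k ν x *
              ∑ i : Fin d, (((‖(fd L M k ν *ᵥ u) (par (lev L k) L M x, i)‖ ^ 2 : ℝ)) : ℂ)).re := by
      refine Finset.sum_congr rfl fun x _ => ?_
      have hreal : (farInd L M k ν x).im = 0 := by unfold farInd; split_ifs <;> simp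
      rw [Complex.mul_re, hreal, zero_mul, sub_zero, ← Complex.ofReal_sum, Complex.ofReal_re, Finset.mul_sum]
    rw [lhs, hre, ← Complex.ofReal_natCast, ← Complex.ofReal_pow]
    simp only [← Complex.ofReal_sum, ← Complex.ofReal_mul, Complex.ofReal_re]
  rw [nsq, Finset.sum_congr rfl (fun x' _ => hpt x'), ← Finset.mul_sum, hsum]
  have e : (L : ℝ) ^ 2 * ((L : ℝ) ^ d)⁻¹ * (L : ℝ) ^ (d - 1) = L := by
    have hL0 : (L : ℝ) ≠ 0 := by exact_mod_cast NeZero.ne L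
    have : (L : ℝ) ^ d = (L : ℝ) * (L : ℝ) ^ (d - 1) := by rw [← pow_succ', Nat.sub_add_cancel hd]
    rw [this]; field_simp
  rw [← mul_assoc, e]

/-- hence `nsq (∇′(J_k M̃_ke_q)) ≤ L·(a·Cst)²`. [folklore] -/
theorem nsq_fdS_Jpc_col_le (k : ℕ) (ν : Fin d) (q : idx L M 0) :
    nsq (fdS L M k ν *ᵥ (Jpc L M k *ᵥ col L M a ha k q)) ≤ (Real.sqrt (L : ℝ) * (a * Cst d a)) ^ 2 := by
  rw [nsq_fdS_Jpc_mulVec, mul_pow, Real.sq_sqrt (Nat.cast_nonneg _)]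
  exact mul_le_mul_of_nonneg_left (nsq_fdiff_col_le L M a ha k ν q) (Nat.cast_nonneg _)

/-! ## §3 The one-step sup rate of the gradient vertex chain, modulo the ZEROTH-order letter only -/

/-- **THE ONE-STEP SUP RATE OF THE GRADIENT VERTEX CHAIN, MODULO `hcol` ONLY** (no gradient sup letter): for every coefficient tensor `C`,
direction `ν`, unit sites∕components `p q r` and every `k`,
`‖V₃ (k+1) C [∇′_νM̃_{k+1}e_p, M̃_{k+1}e_q, M̃_{k+1}e_r] − V₃ k C [∇_νM̃_ke_p, M̃_ke_q, M̃_ke_r]‖ ≤ (2 + 2√L)·‖C‖₁·C·(a·Cst)·(a·CQH)·L^{−k}`.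
[folklore] -/
theorem V₃_gradcol_succ_sub_le {C : ℝ} (hC : 0 ≤ C)
    (hcol : ∀ (k : ℕ) (q : idx L M 0) (X : idx L M k), Real.sqrt (((L : ℝ) ^ d) ^ k) * ‖Mtil L M a ha k X q‖ ≤ C)
    (Cf : Fin d → Fin d → Fin d → ℂ) (ν : Fin d) (p q r : idx L M 0) (k : ℕ) :
    ‖V₃ L (k + 1) Cf (fdS L M k ν *ᵥ colS L M a ha k p) (colS L M a ha k q) (colS L M a ha k r)
        - V₃ L k Cf (fd L M k ν *ᵥ col L M a ha k p) (col L M a ha k q) (col L M a ha k r)‖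
      ≤ (2 + 2 * Real.sqrt L) * (cnorm₃ Cf * (C * ((a * Cst d a) * (a * CQH d a * ((L : ℝ)⁻¹) ^ k)))) := by
  have ht := sqrt_pow_pos (d := d) L (k + 1)
  have hA : 0 ≤ a * Cst d a := mul_nonneg ha.le (Cst_nonneg d a)
  have hε : 0 ≤ a * CQH d a * ((L : ℝ)⁻¹) ^ k := (norm_nonneg _).trans (opNorm_Mtil_succ_sub_le L M a ha k)
  have hsL : 0 ≤ Real.sqrt (L : ℝ) := Real.sqrt_nonneg _
  have hc := cnorm₃_nonneg Cf
  -- transport the coarse vertex to the fine level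
  rw [← V₃_grad_transport L M k ν Cf]
  set B : ℝ := C / Real.sqrt (((L : ℝ) ^ d) ^ (k + 1)) with hB_def
  have hB : 0 ≤ B := div_nonneg hC ht.le
  have hsup' : ∀ (q' : idx L M 0) (z : Tor (fine (L * lev L k) M) × Fin d), ‖colS L M a ha k q' z‖ ≤ B := fun q' z =>
    norm_le_div_of_letter L (fun X => hcol (k + 1) q' X) z
  have hsupJ : ∀ (q' : idx L M 0) (z : Tor (fine (L * lev L k) M) × Fin d), ‖(Jpc L M k *ᵥ col L M a ha k q') z‖ ≤ B := by
    intro q' z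
    refine norm_le_div_of_letter L (k := k + 1) (fun X => ?_) z
    rw [sqrt_mul_norm_Jpc_mulVec]
    exact hcol k q' _
  -- abbreviations
  set δp := colS L M a ha k p - Jpc L M k *ᵥ col L M a ha k p
  set δq := colS L M a ha k q - Jpc L M k *ᵥ col L M a ha k q
  set δr := colS L M a ha k r - Jpc L M k *ᵥ col L M a ha k r
  set F := fdS L M k ν *ᵥ (Jpc L M k *ᵥ col L M a ha k p) with hF
  have hdp : nsq δp ≤ (a * CQH d a * ((L : ℝ)⁻¹) ^ k) ^ 2 := nsq_col_step_le L M a ha k p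
  have hdq : nsq δq ≤ (a * CQH d a * ((L : ℝ)⁻¹) ^ k) ^ 2 := nsq_col_step_le L M a ha k q
  have hdr : nsq δr ≤ (a * CQH d a * ((L : ℝ)⁻¹) ^ k) ^ 2 := nsq_col_step_le L M a ha k r
  have hFn : Real.sqrt (nsq F) ≤ Real.sqrt L * (a * Cst d a) :=
    sqrt_nsq_le_of_sq (mul_nonneg hsL hA) (nsq_fdS_Jpc_col_le L M a ha k ν p)
  -- Leibniz: the differenced gradient leg is `∇′δp`
  have hdiff : fdS L M k ν *ᵥ colS L M a ha k p - F = fdS L M k ν *ᵥ δp := by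
    rw [hF, ← Matrix.mulVec_sub]
  rw [V₃, V₃, ← mul_sub, vtx₃_leibniz, hdiff, norm_mul, Complex.norm_real, Real.norm_of_nonneg ht.le]
  -- term 1: summation by parts
  have t1 : ‖vtx₃ Cf (fdS L M k ν *ᵥ δp) (colS L M a ha k q) (colS L M a ha k r)‖
      ≤ cnorm₃ Cf * (B * ((a * CQH d a * ((L : ℝ)⁻¹) ^ k) * (a * Cst d a)) + B * ((a * CQH d a * ((L : ℝ)⁻¹) ^ k) * (a * Cst d a))) := by
    refine (norm_vtx₃_fdiff_left_le (fine (L * lev L k) M) Cf _ ν δp _ _ hB hB (hsup' q) (hsup' r)).trans ?_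
    refine mul_le_mul_of_nonneg_left (add_le_add ?_ ?_) hc
    · exact mul_le_mul_of_nonneg_left (mul_le_mul (sqrt_nsq_le_of_sq hε hdp) (sqrt_nsq_le_of_sq hA (nsq_fdS_colS_le L M a ha k ν q))
        (Real.sqrt_nonneg _) hε) hB
    · exact mul_le_mul_of_nonneg_left (mul_le_mul (sqrt_nsq_le_of_sq hε hdp) (sqrt_nsq_le_of_sq hA (nsq_fdS_colS_le L M a ha k ν r))
        (Real.sqrt_nonneg _) hε) hB
  -- term 2: `F` in ℓ² (√L·aCst), `δq` in ℓ² (ε), `colS r` in sup (B)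
  have t2 : ‖vtx₃ Cf F δq (colS L M a ha k r)‖ ≤ cnorm₃ Cf * (B * ((Real.sqrt L * (a * Cst d a)) * (a * CQH d a * ((L : ℝ)⁻¹) ^ k))) := by
    refine (norm_vtx₃_le_right Cf F δq _ hB (hsup' r)).trans (mul_le_mul_of_nonneg_left (mul_le_mul_of_nonneg_left ?_ hB) hc)
    exact mul_le_mul hFn (sqrt_nsq_le_of_sq hε hdq) (Real.sqrt_nonneg _) (mul_nonneg hsL hA)
  -- term 3: `F` in ℓ², `J col q` in sup, `δr` in ℓ²
  have t3 : ‖vtx₃ Cf F (Jpc L M k *ᵥ col L M a ha k q) δr‖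
      ≤ cnorm₃ Cf * (B * ((Real.sqrt L * (a * Cst d a)) * (a * CQH d a * ((L : ℝ)⁻¹) ^ k))) := by
    refine (norm_vtx₃_le_mid Cf F _ δr hB (hsupJ q)).trans (mul_le_mul_of_nonneg_left (mul_le_mul_of_nonneg_left ?_ hB) hc)
    exact mul_le_mul hFn (sqrt_nsq_le_of_sq hε hdr) (Real.sqrt_nonneg _) (mul_nonneg hsL hA)
  have hsum : ‖vtx₃ Cf (fdS L M k ν *ᵥ δp) (colS L M a ha k q) (colS L M a ha k r) + vtx₃ Cf F δq (colS L M a ha k r)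
        + vtx₃ Cf F (Jpc L M k *ᵥ col L M a ha k q) δr‖
      ≤ (2 + 2 * Real.sqrt L) * (cnorm₃ Cf * (B * ((a * Cst d a) * (a * CQH d a * ((L : ℝ)⁻¹) ^ k)))) := by
    calc _ ≤ ‖vtx₃ Cf (fdS L M k ν *ᵥ δp) (colS L M a ha k q) (colS L M a ha k r) + vtx₃ Cf F δq (colS L M a ha k r)‖
            + ‖vtx₃ Cf F (Jpc L M k *ᵥ col L M a ha k q) δr‖ := norm_add_le _ _
      _ ≤ ‖vtx₃ Cf (fdS L M k ν *ᵥ δp) (colS L M a ha k q) (colS L M a ha k r)‖ + ‖vtx₃ Cf F δq (colS L M a ha k r)‖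
            + ‖vtx₃ Cf F (Jpc L M k *ᵥ col L M a ha k q) δr‖ := by gcongr; exact norm_add_le _ _
      _ ≤ _ := add_le_add (add_le_add t1 t2) t3
      _ = (2 + 2 * Real.sqrt L) * (cnorm₃ Cf * (B * ((a * Cst d a) * (a * CQH d a * ((L : ℝ)⁻¹) ^ k)))) := by ring
  calc Real.sqrt (((L : ℝ) ^ d) ^ (k + 1)) * ‖vtx₃ Cf (fdS L M k ν *ᵥ δp) (colS L M a ha k q) (colS L M a ha k r)
          + vtx₃ Cf F δq (colS L M a ha k r) + vtx₃ Cf F (Jpc L M k *ᵥ col L M a ha k q) δr‖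
      ≤ Real.sqrt (((L : ℝ) ^ d) ^ (k + 1))
          * ((2 + 2 * Real.sqrt L) * (cnorm₃ Cf * (B * ((a * Cst d a) * (a * CQH d a * ((L : ℝ)⁻¹) ^ k))))) :=
        mul_le_mul_of_nonneg_left hsum ht.le
    _ = (2 + 2 * Real.sqrt L) * (cnorm₃ Cf * ((Real.sqrt (((L : ℝ) ^ d) ^ (k + 1)) * B)
          * ((a * Cst d a) * (a * CQH d a * ((L : ℝ)⁻¹) ^ k)))) := by ring
    _ = (2 + 2 * Real.sqrt L) * (cnorm₃ Cf * (C * ((a * Cst d a) * (a * CQH d a * ((L : ℝ)⁻¹) ^ k)))) := by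
        rw [hB_def, mul_div_cancel₀ _ ht.ne']

end Summit.QuantumFields.BalabanUV.Beta.GAN24.SoftColumnGradVertexRate

end
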